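import Summits.ResolutionOfSingularities.ResolutionOfSingularities.Theorems.WeightedInvariantKeyRungThreeOfDropCurveFracTieZero
import Summits.ResolutionOfSingularities.ResolutionOfSingularities.Theorems.WeightedInvariantJFlatEssSmoothFaceLemmas
import HarnessLib

/-!
# At the pinned successor `(t⁻¹, z, Y)` of a curve centre tied at `λ = 0` the ORDER PERSISTS: `g/1 ∈ 𝔪_{B_𝔫}^ν`
# (door `HypersurfaceCentreConstruction`, stmt-ResolutionOfSingularities-19897; residual (D-b³-curve-FRAC-TIE-ZERO) of `stub_keyRungGrHomLE_three`)

Topic: `Summits/ResolutionOfSingularities/ResolutionOfSingularities/Theorems`. Helper for the door item `HypersurfaceCentreConstruction`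
(stmt-ResolutionOfSingularities-19897, route `WeightedInvariant`), line `local-engine`, def-free.  Orientation lemma for the residual
(D-b³-curve-FRAC-TIE-ZERO) of the gap list of record `keyRungGrHomLE_three_of_tieDescent_point_curveFracTieZero` (…KeyRungThreeOfDropCurveFracTieZero):
at the one `t`-homogeneous successor `𝔫 = (t⁻¹, z, W)`, `y = (t⁻¹)^r W`, of the P3a cylinder move `B = S[t⁻¹, 𝒥ₙ((y,x);(r,q)) tⁿ]` at a position tied at
`λ = 0` (`f ∈ 𝒥_{(r+1)ν}((x, y, z); (q, r+1, 1))`), the saturated transform `g` of `f ∈ 𝒥_{rν} ∖ 𝔪^{ν+1}` has `g/1 ∈ 𝔪_{B_𝔫}^ν` — the order letter of `ι₃ᵗ`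
does NOT drop there, so the `ι₃ᵗ`-drop demanded by the residual must come from the finer letters (`ε`, `τ`, `σ`; CURVE-TIE.md §3 (ii)).
Proof: `f = (t⁻¹)^{rν} g` (uniqueness of the saturated factorisation, …P3aSpecialFibreFace), `x = (t⁻¹)^q X`, `y = (t⁻¹)^r W`, `z ∈ 𝔫` put
`𝒥_m((x, y, z); (q, r+1, 1))` inside `𝔪_{B_𝔫}^m`, so `(t⁻¹)^{rν} g ∈ 𝔪_{B_𝔫}^{(r+1)ν}`; `t⁻¹/1` is a regular parameter of the regular local ring `B_𝔫`
(`∉ 𝔪²`), and the order is a valuation (`JFlatEssSmooth.mem_pow_pred_of_mul_mem_pow`).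

* `LocalGameEFTCylinder.mem_pow_sub_of_pow_mul_mem_pow` — `s ∉ 𝔪²`, `s^k a ∈ 𝔪^m ⇒ a ∈ 𝔪^{m-k}` in a regular local ring.
* `LocalGameEFTCylinder.transform_eq_of_saturated` — every saturated factorisation `f = (t⁻¹)ᵃ g` of `f ∈ 𝒥_{rν} ∖ 𝔪^{ν+1}` has `a = rν`.
* **`LocalGameEFTCylinder.transform_mem_pow_of_mem_tieZero`** (chart form, `W = Y`), **`Iota3.transform_mem_pow_of_mem_tieZero_aux`** /
  **`Iota3.transform_mem_pow_of_mem_tieZero`** (every presentation `(u, w)`, intrinsic `W` with `y = (t⁻¹)^r W`, the binder data of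
  (D-b³-curve-FRAC-TIE-ZERO)).
[OURS · L1 W4.3 · (D-b³-curve-FRAC-TIE) orientation]  Replaces the role of NO printed item; NOT a statement of the manuscript under review
[claim: Hironaka2017, status: under-review]; candidates stay candidates; AI work, weaker than expert review.  No definition; no axiom.

## References

* H. Matsumura, *Commutative Ring Theory* (1986), Thm. 14.3 (the order function of a regular local ring). [Matsumura1987]
* J. Włodarczyk, *Functorial resolution by torus actions*, arXiv:2203.03090, §2.3.9, §3.3. [Wlodarczyk2022]
-/

noncomputable section

open IsLocalRing Literature.AlgebraicGeometry.Resolution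
open Summit.ResolutionOfSingularities.ResolutionOfSingularities.Cruxes.HypersurfaceCentreConstruction.LocalEngine

set_option linter.dupNamespace false -- mandated namespace of this single-conjunct summit

namespace Summit.ResolutionOfSingularities.ResolutionOfSingularities.Theorems

namespace LocalGameEFTCylinder

/-- In a regular local ring, `s ∉ 𝔪²` and `s^k a ∈ 𝔪^m` give `a ∈ 𝔪^{m-k}` (the order is a valuation). [cite: Matsumura1987, Thm. 14.3] -/
theorem mem_pow_sub_of_pow_mul_mem_pow {L : Type} [CommRing L] [IsRegularLocalRing L] {s : L} (hs : s ∈ maximalIdeal L)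
    (hs2 : s ∉ maximalIdeal L ^ 2) (k : ℕ) : ∀ {m : ℕ} {a : L}, s ^ k * a ∈ maximalIdeal L ^ m → a ∈ maximalIdeal L ^ (m - k) := by
  induction k with
  | zero => intro m a h; rw [Nat.sub_zero]; rwa [pow_zero, one_mul] at h
  | succ k ih =>
    intro m a h
    rw [pow_succ, mul_assoc] at h
    have h1 := ih h
    have h2 := JFlatEssSmooth.mem_pow_pred_of_mul_mem_pow hs hs2 h1
    rwa [show m - k - 1 = m - (k + 1) by omega] at h2

/-- The tie-at-zero filtration lands in the powers of the maximal ideal of any local ring `L` over `S` in which `x = s^q X`, `y = s^r Y` with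
`s, Y, z ∈ 𝔪_L`. [folklore] -/
theorem weightedMonomialIdeal_tieZero_le_comap_pow {S L : Type} [CommRing S] [CommRing L] [IsLocalRing L] (φ : S →+* L) {x y z : S}
    {q r : ℕ} {sL XL YL : L} (hx : φ x = sL ^ q * XL) (hy : φ y = sL ^ r * YL) (hs : sL ∈ maximalIdeal L)
    (hY : YL ∈ maximalIdeal L) (hz : φ z ∈ maximalIdeal L) (m : ℕ) :
    weightedMonomialIdeal ![x, y, z] ![q, r + 1, 1] m ≤ (maximalIdeal L ^ m).comap φ := by
  refine weightedMonomialIdeal_le_of_forall_mem_of_mul_le (fun m => (maximalIdeal L ^ m).comap φ)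
    (by rw [pow_zero, Ideal.one_eq_top, Ideal.comap_top]) (fun a b => ?_)
    (fun a b hab => Ideal.comap_mono (Ideal.pow_le_pow_right hab)) ![x, y, z] ![q, r + 1, 1] (fun i => ?_) m
  · rw [pow_add]; exact Ideal.le_comap_mul _
  · fin_cases i
    · show x ∈ (maximalIdeal L ^ q).comap φ
      rw [Ideal.mem_comap, hx]
      exact Ideal.mul_mem_right _ _ (Ideal.pow_mem_pow hs q)
    · show y ∈ (maximalIdeal L ^ (r + 1)).comap φ
      rw [Ideal.mem_comap, hy, pow_succ]
      exact Ideal.mul_mem_mul (Ideal.pow_mem_pow hs r) hY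
    · show z ∈ (maximalIdeal L ^ 1).comap φ
      rw [Ideal.mem_comap, pow_one]
      exact hz

/-- In a regular local ring of dimension `3` with `𝔪 = (a, b, c)`, the generator `a` is not in `𝔪²`. [cite: Matsumura1987, Thm. 14.2] -/
theorem not_mem_sq_of_span_triple_eq {L : Type} [CommRing L] [IsRegularLocalRing L] (hdim : ringKrullDim L = (3 : ℕ)) {a b c : L}
    (h : Ideal.span {a, b, c} = maximalIdeal L) : a ∉ maximalIdeal L ^ 2 := by
  have h' : Ideal.span (Set.range ![a, b, c]) = maximalIdeal L := by rw [Iota3.range_three]; exact h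
  have hli := linearIndependent_toCotangent_of_span_eq_maximalIdeal hdim _ h'
  intro h2
  exact hli.ne_zero 0 ((Ideal.toCotangent_eq_zero _ _).mpr h2)

section Chart

variable {S : Type} [CommRing S] [IsRegularLocalRing S] {y x z : S} {r q : ℕ}

/-- **Every saturated factorisation is the transform**: for `f ∈ 𝒥_{rν}((y,x);(r,q)) ∖ 𝔪^{ν+1}` (`0 < q ≤ r`, rsp `(y, x, z)`), `f = (t⁻¹)ᵃ g` with
`t⁻¹ ∤ g` forces `a = rν` (the special-fibre face of the transform is non-zero). [cite: Wlodarczyk2022, §3.3] -/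
theorem transform_eq_of_saturated (hyxz : Ideal.span (Set.range ![y, x, z]) = maximalIdeal S)
    (hd : (maximalIdeal S).spanFinrank = 3) (hq : 0 < q) (hqr : q ≤ r) {ν : ℕ} {f : S}
    (hfν : f ∉ maximalIdeal S ^ (ν + 1)) (hadm : f ∈ weightedMonomialIdeal ![y, x] ![r, q] (r * ν))
    {a : ℕ} {g : extReesAlgebra (weightedMonomialIdeal ![y, x] ![r, q])}
    (hfg : algebraMap S _ f = extReesAlgebra.tInv (weightedMonomialIdeal ![y, x] ![r, q]) ^ a * g)
    (hndvd : ¬ extReesAlgebra.tInv (weightedMonomialIdeal ![y, x] ![r, q]) ∣ g) : a = r * ν := by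
  classical
  haveI := isDomain_of_isRegularLocalRing S
  have hr : 0 < r := lt_of_lt_of_le hq hqr
  have hw : ∀ i, 0 < (![r, q] : Fin 2 → ℕ) i := weights_pos hq hqr
  obtain ⟨ρ₀, _, _, hX, hC, hT0⟩ := exists_rhoZero hyxz hd ![r, q] hw
  obtain ⟨l, hl, hfl⟩ := exists_finsupp_of_mem_weightedMonomialIdeal ![y, x] ![r, q] hadm
  obtain ⟨G, hG, hρG⟩ := exists_transform_of_finsupp ![y, x] ![r, q] (residue S) ρ₀ hX hC hT0 l hl hfl
  have hres : ∀ a : S, residue S a = 0 → a ∈ maximalIdeal S := fun a ha => (residue_eq_zero_iff _).mp ha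
  have hΦne := face_ne_zero hyxz hr hqr hres l hl hfl hfν
  have hndG : ¬ extReesAlgebra.tInv (weightedMonomialIdeal ![y, x] ![r, q]) ∣ G :=
    not_dvd_of_map_ne_zero _ _ ρ₀ hT0 (by rw [hρG]; exact hΦne)
  exact (transform_unique₀ ![y, x] ![r, q] hG hndG hfg hndvd).1

/-- **ORDER PERSISTS at the pinned point of a tie at `λ = 0`** (chart form, target-generic).  `f ∈ 𝒥_{rν}((y,x);(r,q)) ∖ 𝔪^{ν+1}` with
`f ∈ 𝒥_{(r+1)ν}((x, y, z); (q, r+1, 1))`; `ψ : B → L` a ring map into a regular local ring with `ψ(t⁻¹), ψ(Y), ψ(z) ∈ 𝔪_L` and `ψ(t⁻¹) ∉ 𝔪_L²`;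
(`y = (t⁻¹)^r W`, `ψ(W) ∈ 𝔪_L`); then every saturated transform has `ψ g ∈ 𝔪_L^ν`. [OURS · L1 W4.3 · orientation] [cite: Matsumura1987, Thm. 14.3] -/
theorem transform_mem_pow_of_mem_tieZero (hyxz : Ideal.span (Set.range ![y, x, z]) = maximalIdeal S)
    (hd : (maximalIdeal S).spanFinrank = 3) (hq : 0 < q) (hqr : q ≤ r) {ν : ℕ} {f : S}
    (hfν : f ∉ maximalIdeal S ^ (ν + 1)) (hadm : f ∈ weightedMonomialIdeal ![y, x] ![r, q] (r * ν))
    (htie0 : f ∈ weightedMonomialIdeal ![x, y, z] ![q, r + 1, 1] ((r + 1) * ν))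
    {L : Type} [CommRing L] [IsRegularLocalRing L] (ψ : extReesAlgebra (weightedMonomialIdeal ![y, x] ![r, q]) →+* L)
    (hT : ψ (extReesAlgebra.tInv (weightedMonomialIdeal ![y, x] ![r, q])) ∈ maximalIdeal L)
    {W : extReesAlgebra (weightedMonomialIdeal ![y, x] ![r, q])}
    (hWy : algebraMap S _ y = extReesAlgebra.tInv (weightedMonomialIdeal ![y, x] ![r, q]) ^ r * W)
    (hY : ψ W ∈ maximalIdeal L) (hz : ψ (algebraMap S _ z) ∈ maximalIdeal L)
    (hs2 : ψ (extReesAlgebra.tInv (weightedMonomialIdeal ![y, x] ![r, q])) ∉ maximalIdeal L ^ 2)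
    {a : ℕ} {g : extReesAlgebra (weightedMonomialIdeal ![y, x] ![r, q])}
    (hfg : algebraMap S _ f = extReesAlgebra.tInv (weightedMonomialIdeal ![y, x] ![r, q]) ^ a * g)
    (hndvd : ¬ extReesAlgebra.tInv (weightedMonomialIdeal ![y, x] ![r, q]) ∣ g) : ψ g ∈ maximalIdeal L ^ ν := by
  have ha : a = r * ν := transform_eq_of_saturated hyxz hd hq hqr hfν hadm hfg hndvd
  have hx' : (ψ.comp (algebraMap S (extReesAlgebra (weightedMonomialIdeal ![y, x] ![r, q])))) x =
      ψ (extReesAlgebra.tInv (weightedMonomialIdeal ![y, x] ![r, q])) ^ q * ψ (LocalGameEFTPointMove.uT ![y, x] ![r, q] 1) := by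
    rw [RingHom.comp_apply, algebraMap_x_eq, map_mul, map_pow]
  have hy' : (ψ.comp (algebraMap S (extReesAlgebra (weightedMonomialIdeal ![y, x] ![r, q])))) y =
      ψ (extReesAlgebra.tInv (weightedMonomialIdeal ![y, x] ![r, q])) ^ r * ψ W := by
    rw [RingHom.comp_apply, hWy, map_mul, map_pow]
  have hz' : (ψ.comp (algebraMap S (extReesAlgebra (weightedMonomialIdeal ![y, x] ![r, q])))) z ∈ maximalIdeal L := by
    rw [RingHom.comp_apply]; exact hz
  have hfL := weightedMonomialIdeal_tieZero_le_comap_pow _ hx' hy' hT hY hz' _ htie0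
  rw [Ideal.mem_comap, RingHom.comp_apply, hfg, map_mul, map_pow, ha] at hfL
  have h := mem_pow_sub_of_pow_mul_mem_pow hT hs2 (r * ν) hfL
  rwa [show (r + 1) * ν - r * ν = ν by rw [add_mul, one_mul, Nat.add_sub_cancel_left]] at h

end Chart

end LocalGameEFTCylinder

end Summit.ResolutionOfSingularities.ResolutionOfSingularities.Theorems

namespace Summit.ResolutionOfSingularities.ResolutionOfSingularities.Cruxes.HypersurfaceCentreConstruction.LocalEngine

namespace Iota3

open Summit.ResolutionOfSingularities.ResolutionOfSingularities.Theorems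

/-- Carrier transport: ORDER PERSISTS, on the extended Rees algebra of ANY filtration equal to `𝒥((y,x);(r,q))`, with the regular-threefold data of the
(D-b³-curve-FRAC-TIE-ZERO) binder (`𝔫 = (t⁻¹, z, W)`, `y = (t⁻¹)^r W`, `B_𝔫` regular local of dimension `3`, `(t⁻¹, z, W)/1` spanning `𝔪`).
[OURS · L1 W4.3 · seam] -/
theorem transform_mem_pow_of_mem_tieZero_aux {S : Type} [CommRing S] [IsRegularLocalRing S] {y x z : S} {q r ν : ℕ} {f : S}
    (hyxz : Ideal.span (Set.range ![y, x, z]) = maximalIdeal S) (hd : (maximalIdeal S).spanFinrank = 3)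
    (hq : 0 < q) (hqr : q ≤ r) (hfν : f ∉ maximalIdeal S ^ (ν + 1)) (hadm : f ∈ weightedMonomialIdeal ![y, x] ![r, q] (r * ν))
    (htie0 : f ∈ weightedMonomialIdeal ![x, y, z] ![q, r + 1, 1] ((r + 1) * ν))
    {I : ℕ → Ideal S} (hI : I = weightedMonomialIdeal ![y, x] ![r, q]) :
    ∀ (𝔫 : Ideal (extReesAlgebra I)) [𝔫.IsPrime], maximalIdeal S ≤ 𝔫.comap (algebraMap S (extReesAlgebra I)) →
      ∀ W : extReesAlgebra I, algebraMap S (extReesAlgebra I) y = extReesAlgebra.tInv I ^ r * W →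
        𝔫 = Ideal.span {extReesAlgebra.tInv I, algebraMap S (extReesAlgebra I) z, W} →
        IsRegularLocalRing (Localization.AtPrime 𝔫) → ringKrullDim (Localization.AtPrime 𝔫) = (3 : ℕ) →
        Ideal.span {algebraMap _ (Localization.AtPrime 𝔫) (extReesAlgebra.tInv I),
          algebraMap _ (Localization.AtPrime 𝔫) (algebraMap S (extReesAlgebra I) z),
          algebraMap _ (Localization.AtPrime 𝔫) W} = maximalIdeal (Localization.AtPrime 𝔫) →
        ∀ (a : ℕ) (g : extReesAlgebra I), algebraMap S (extReesAlgebra I) f = extReesAlgebra.tInv I ^ a * g →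
          ¬ extReesAlgebra.tInv I ∣ g →
          algebraMap (extReesAlgebra I) (Localization.AtPrime 𝔫) g ∈ maximalIdeal (Localization.AtPrime 𝔫) ^ ν := by
  subst hI
  intro 𝔫 _ hM W hW h𝔫 hreg hdim hspan a g hfg hTg
  haveI := hreg
  have hT : extReesAlgebra.tInv (weightedMonomialIdeal ![y, x] ![r, q]) ∈ 𝔫 := by
    rw [h𝔫]; exact Ideal.subset_span (Set.mem_insert _ _)
  have hWn : W ∈ 𝔫 := by
    rw [h𝔫]; exact Ideal.subset_span (Set.mem_insert_of_mem _ (Set.mem_insert_of_mem _ (Set.mem_singleton _)))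
  have hmemL : ∀ b : extReesAlgebra (weightedMonomialIdeal ![y, x] ![r, q]), b ∈ 𝔫 →
      algebraMap _ (Localization.AtPrime 𝔫) b ∈ maximalIdeal (Localization.AtPrime 𝔫) := fun b hb => by
    rw [← Localization.AtPrime.map_eq_maximalIdeal]; exact Ideal.mem_map_of_mem _ hb
  have hs2 := LocalGameEFTCylinder.not_mem_sq_of_span_triple_eq (L := Localization.AtPrime 𝔫) hdim hspan
  exact LocalGameEFTCylinder.transform_mem_pow_of_mem_tieZero hyxz hd hq hqr hfν hadm htie0 (L := Localization.AtPrime 𝔫)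
    (algebraMap _ (Localization.AtPrime 𝔫)) (hmemL _ hT) hW (hmemL _ hWn) (hmemL _ (hM (hyxz ▸ Ideal.subset_span ⟨2, rfl⟩))) hs2 hfg hTg

/-- **ORDER PERSISTS at the residual point of (D-b³-curve-FRAC-TIE-ZERO), for every presentation `(u, w)`**: with the binder data of
`keyRungGrHomLE_three_of_tieDescent_point_curveFracTieZero` (tie at `λ = 0`, `𝔫 = (t⁻¹, z, W)`, `y = (t⁻¹)^b W`, regular local threefold),
every saturated transform has `g/1 ∈ 𝔪_{B_𝔫}^ν`.  So the `ι₃ᵗ`-drop demanded there is NOT an order drop.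
[OURS · L1 W4.3 · orientation] [cite: Matsumura1987, Thm. 14.3] [cite: Wlodarczyk2022, §3.3] -/
theorem transform_mem_pow_of_mem_tieZero {S : Type} [CommRing S] [IsRegularLocalRing S] {y x z : S} {q r ν : ℕ} {f : S}
    (hyxz : Ideal.span (Set.range ![y, x, z]) = maximalIdeal S) (hd : (maximalIdeal S).spanFinrank = 3)
    (hq : 0 < q) (hqr : q ≤ r) (hfν : f ∉ maximalIdeal S ^ (ν + 1)) (hadm : f ∈ weightedMonomialIdeal ![y, x] ![r, q] (r * ν))
    (htie0 : f ∈ weightedMonomialIdeal ![x, y, z] ![q, r + 1, 1] ((r + 1) * ν))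
    {n : ℕ} (u : Fin n → S) (w : Fin n → ℕ) (hpres : ∀ m : ℕ, weightedMonomialIdeal u w m = weightedMonomialIdeal ![y, x] ![r, q] m)
    (𝔫 : Ideal (cobordantAlgebra' u w)) [𝔫.IsPrime] (hM : (maximalIdeal S).map (algebraMap S (cobordantAlgebra' u w)) ≤ 𝔫)
    (W : cobordantAlgebra' u w) (hW : algebraMap S (cobordantAlgebra' u w) y = cobordantT' u w ^ r * W)
    (h𝔫 : 𝔫 = Ideal.span {cobordantT' u w, algebraMap S (cobordantAlgebra' u w) z, W})
    (hreg : IsRegularLocalRing (Localization.AtPrime 𝔫)) (hdim : ringKrullDim (Localization.AtPrime 𝔫) = (3 : ℕ))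
    (hspan : Ideal.span {algebraMap _ (Localization.AtPrime 𝔫) (cobordantT' u w),
      algebraMap _ (Localization.AtPrime 𝔫) (algebraMap S (cobordantAlgebra' u w) z),
      algebraMap _ (Localization.AtPrime 𝔫) W} = maximalIdeal (Localization.AtPrime 𝔫))
    {a : ℕ} {g : cobordantAlgebra' u w} (hfg : algebraMap S (cobordantAlgebra' u w) f = cobordantT' u w ^ a * g)
    (hTg : ¬ cobordantT' u w ∣ g) :
    algebraMap (cobordantAlgebra' u w) (Localization.AtPrime 𝔫) g ∈ maximalIdeal (Localization.AtPrime 𝔫) ^ ν :=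
  transform_mem_pow_of_mem_tieZero_aux hyxz hd hq hqr hfν hadm htie0 (funext hpres) 𝔫 (Ideal.map_le_iff_le_comap.mp hM) W hW h𝔫 hreg
    hdim hspan a g hfg hTg

end Iota3

end Summit.ResolutionOfSingularities.ResolutionOfSingularities.Cruxes.HypersurfaceCentreConstruction.LocalEngine

end
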